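import Literature.NumberTheory.LFunctions.DirichletLFunctionPolyaVinogradovBound
import Literature.NumberTheory.LFunctions.Zhang2022.Section3SubconvexInput

/-!
# Zhang (2022), Lemma 3.1 / Lemma 3.2: the integrand majorant on the shifted line, from the
# tree's Pólya–Vinogradov convexity bound — `‖L(s,χ)‖^k · q^{−a(1−σ)} ≤ C(q,s)^k · q^{(k/2−a)(1−σ)}`

Trunk T-ANT (NumberTheory/LFunctions). Y. Zhang, *Discrete mean estimates and the Landau–Siegel
zero*, arXiv:2211.02515v1 (2022) [Zhang2022LandauSiegel], §3, Lemmas 3.1 and 3.2. **Status of the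
source: an unrefereed manuscript, a claimed result under adjudication** (audit + repair census of
arXiv:2211.02515; no claim about Landau–Siegel is made here). Everything in this file is PROVED
(theorems only; no definition, no named fact).

THE STEP. Both lemmas are proved (Lemma 3.2 only sketched) by writing the partial sum as
`(1/2πi)∫_{(1)} Φ(1+s) ζ(1+s)^k L(1+s,χ)^k K(s) ds` with a kernel `K(s) = (X^{s} − D^{4s})Γ(s)`
(`X = P` in Lemma 3.1, `X = D⁸` in Lemma 3.2) and "moving the line of integration to the left
appropriately and applying standard estimates" [p. 7 of the source]. On the line `Re(1+s) = σ`,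
`½ ≤ σ < 1`, the piece of the kernel that decides the error term has modulus
`|D^{4s}| = D^{−4(1−σ)}` (more generally `D^{−a(1−σ)}` for a cut `D^{a}`), and the question is
whether `|L(σ+it,χ)|^k · D^{−a(1−σ)}` still DECAYS as a power of `D` — the contour-shift saving rule
`Section3SubconvexInput.Saves k a μ := 2kμ < a` of the cell's ALT-1 rows, `μ` being the exponent of
the conductor in the size bound used for `L(½+it,χ)`.

THIS FILE makes the rule an inequality between the actual objects for the CONVEXITY exponent
`μ = ¼`, using the tree theorem
`DirichletAbel.norm_LFunction_le_polyaVinogradov_of_half_le` (Pólya–Vinogradov + partial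
summation: `‖L(s,χ)‖ ≤ e^{3/2}(√q(1+log q))^{1−σ}(1+log q)‖s‖` for `χ` primitive mod `q ≥ 8`,
`½ ≤ σ ≤ 1` — [MontgomeryVaughan2007, Thm 9.18 with (4.23)]):
* `norm_LFunction_le_logConst_mul_rpow` — `‖L(s,χ)‖ ≤ C(q,s)·q^{(1−σ)/2}` with the logarithmic
  constant `C(q,s) = e^{3/2}(1+log q)^{2−σ}‖s‖` (written out in every statement; polynomial in
  `log q` and `‖s‖` — in the contour shift `‖s‖^k` is absorbed by the decay of `Γ(s)` and powers of
  `log q = 𝓛` are `q^{o(1)}`): the convexity exponent `(1−σ)/2` in `q`, i.e. `2μ(1−σ)` at `μ = ¼`;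
* `pow_norm_LFunction_mul_rpow_le` — for every `k : ℕ` and real `a`:
  `‖L(s,χ)‖^k · q^{−a(1−σ)} ≤ C(q,s)^k · q^{(k/2 − a)(1−σ)}`;
* the four instances that are rows of the cell's constraint system:
  Lemma 3.1 (`k = 2`, cut `D⁴`): `≤ C² q^{−3(1−σ)}` (`lemma31_shiftedLine_le`, row T-ALT1a);
  the cell's Lemma 3.2♭ = variant A11 (`ν²τ₂`, `ζ⁴L⁴`, `k = 4`, cut `D⁴`): `≤ C⁴ q^{−2(1−σ)}`
  (`lemma32flat_shiftedLine_le`, row T-ALT1f) — a genuine power saving WITHOUT any subconvex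
  input; the printed Lemma 3.2 (`ν²τ₂²`, `ζ⁸L⁸`, `k = 8`, cut `D⁴`): `≤ C⁸ · q⁰` only
  (`lemma32_shiftedLine_le_polyaVinogradov`, row T-ALT1c: at convexity strength the majorant does
  NOT decay in `q`; the printed route needs an exponent `μ < ¼`, e.g. Burgess `3/16`
  [IwaniecKowalski2004, Thm 12.9], which is not in the tree); and the design variant A6
  (`k = 8`, cut `D⁵`): `≤ C⁸ q^{−(1−σ)}` (`lemma32_cut5_shiftedLine_le`);
* `exponent_neg_iff_saves` — for `σ < 1` the exponent `(k/2 − a)(1−σ)` is negative iff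
  `Saves k a ¼`, tying this file to `Section3SubconvexInput` (`saves_lemma31_convexity`,
  `saves_lemma32flat_convexity`, `not_saves_lemma32_convexity`, `saves_lemma32_convexity_cut_iff`).

Scope (what is NOT here): the contour shift itself (Mellin inversion, the horizontal segments,
`Γ`-decay absorbing the factor `‖s‖^k`, the bound `Φ(1+s) = D^{o(1)}` on the shifted line), the
residue bookkeeping on `|s| = α*` (rational arithmetic in `Section3SubconvexInput.residueExp`), and
`∑ τ₂ν²/n ≪ 𝓛^{−2015}` under (A) — by hand in the cell's `ALT-1.md` §4 (3), re-derived by its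
referee-2. In the source `q = |D|` (a fundamental discriminant, so `χ = (D/·)` is primitive and
`|D| ≥ 8` except `D ∈ {−3, −4, 5, −7}`, immaterial for `D → ∞`) and the line is `Re(1+s) = σ = 1−η`.
VERDICT-NEUTRAL: nothing here bears on the cell's localisation of the failing step (8.24)
(`Section8Certificate.not_ineq824`), whose certificate contains no parameter of this layer. No
statement about Theorems 1–2 of the source is made or implied.

References: [Zhang2022LandauSiegel, §3 Lemma 3.1 (proof), Lemma 3.2 (sketch)];
[MontgomeryVaughan2007, §9.4 Thm 9.18, §4.3 (4.23)]; [IwaniecKowalski2004, Thm 12.9] (Burgess,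
cited for contrast only); cell record `HOME/b2b-zhang-alt-1/ALT-1.md` §§2–4, §15 (rows T-ALT1a,
T-ALT1c, T-ALT1f; variant A6).
-/

noncomputable section

open Complex

namespace Literature.NumberTheory.LFunctions.Zhang2022.Section3ShiftedLineMajorant

open Literature.NumberTheory.LFunctions.Zhang2022.Section3SubconvexInput (Saves)

variable {q : ℕ} [NeZero q] (χ : DirichletCharacter ℂ q)

/-- The logarithmic constant `C(q,s) = e^{3/2} (1 + log q)^{2−σ} ‖s‖` is `≥ 0` (`q ≥ 1`).
[folklore] -/
theorem logConst_nonneg (q : ℕ) (hq : 1 ≤ q) (s : ℂ) :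
    0 ≤ Real.exp (3 / 2) * (1 + Real.log q) ^ (2 - s.re) * ‖s‖ := by
  have hlog : 0 ≤ Real.log q := Real.log_nonneg (by exact_mod_cast hq)
  have h1 : 0 ≤ (1 + Real.log q) ^ (2 - s.re) := Real.rpow_nonneg (by linarith) _
  positivity

/-- **Convexity exponent in `q`, separated form.** For `χ` primitive mod `q ≥ 8` and
`½ ≤ σ = Re s ≤ 1`: `‖L(s,χ)‖ ≤ C(q,s) · q^{(1−σ)/2}` — the tree's Pólya–Vinogradov bound
`DirichletAbel.norm_LFunction_le_polyaVinogradov_of_half_le` with `(√q)^{1−σ} = q^{(1−σ)/2}` and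
the logarithms collected into `C(q,s) = e^{3/2}(1+log q)^{2−σ}‖s‖`. The exponent
`(1−σ)/2 = 2μ(1−σ)` is the convexity exponent `μ = ¼` interpolated linearly between `σ = ½` and
`σ = 1`.
[cite: MontgomeryVaughan2007, §9.4 Thm 9.18 with §4.3 (4.23)] [folklore] -/
theorem norm_LFunction_le_logConst_mul_rpow (hq : 8 ≤ q) (hχ : χ.IsPrimitive) {s : ℂ}
    (hs0 : 1 / 2 ≤ s.re) (hs1 : s.re ≤ 1) :
    ‖χ.LFunction s‖ ≤
      (Real.exp (3 / 2) * (1 + Real.log q) ^ (2 - s.re) * ‖s‖) * (q : ℝ) ^ ((1 - s.re) / 2) := by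
  have h :=
    Literature.NumberTheory.LFunctions.DirichletAbel.norm_LFunction_le_polyaVinogradov_of_half_le
      χ hq hχ hs0 hs1
  have hq0 : (0 : ℝ) < q := by exact_mod_cast (show 0 < q by omega)
  have hq1 : (1 : ℝ) ≤ q := by exact_mod_cast (show 1 ≤ q by omega)
  have hlog : 0 ≤ Real.log q := Real.log_nonneg hq1
  have hL : 0 < 1 + Real.log q := by linarith
  have hsqrt : 0 ≤ Real.sqrt q := Real.sqrt_nonneg _
  -- `(√q (1+log q))^{1−σ} = q^{(1−σ)/2} (1+log q)^{1−σ}`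
  have hsplit : (Real.sqrt q * (1 + Real.log q)) ^ (1 - s.re) =
      (q : ℝ) ^ ((1 - s.re) / 2) * (1 + Real.log q) ^ (1 - s.re) := by
    rw [Real.mul_rpow hsqrt hL.le, Real.sqrt_eq_rpow, ← Real.rpow_mul hq0.le]
    congr 1
    ring_nf
  -- `(1+log q)^{1−σ} (1+log q) = (1+log q)^{2−σ}`
  have hpow : (1 + Real.log q) ^ (1 - s.re) * (1 + Real.log q) =
      (1 + Real.log q) ^ (2 - s.re) := by
    rw [show (2 : ℝ) - s.re = (1 - s.re) + 1 by ring, Real.rpow_add hL, Real.rpow_one]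
  calc ‖χ.LFunction s‖
      ≤ Real.exp (3 / 2) * (Real.sqrt q * (1 + Real.log q)) ^ (1 - s.re) * (1 + Real.log q) *
          ‖s‖ := h
    _ = Real.exp (3 / 2) * ((1 + Real.log q) ^ (1 - s.re) * (1 + Real.log q)) * ‖s‖ *
          (q : ℝ) ^ ((1 - s.re) / 2) := by rw [hsplit]; ring
    _ = (Real.exp (3 / 2) * (1 + Real.log q) ^ (2 - s.re) * ‖s‖) *
          (q : ℝ) ^ ((1 - s.re) / 2) := by rw [hpow]

/-- **The shifted-line majorant.** For `χ` primitive mod `q ≥ 8`, `½ ≤ σ = Re s ≤ 1`, every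
number `k` of `L`-factors and every cut exponent `a`:
`‖L(s,χ)‖^k · q^{−a(1−σ)} ≤ C(q,s)^k · q^{(k/2 − a)(1−σ)}`.
This is the convexity instance (`μ = ¼`) of the saving rule `Saves k a μ := 2kμ < a`: the right
side decays in `q` iff `k/2 < a` (`exponent_neg_iff_saves`). [folklore] -/
theorem pow_norm_LFunction_mul_rpow_le (hq : 8 ≤ q) (hχ : χ.IsPrimitive) {s : ℂ}
    (hs0 : 1 / 2 ≤ s.re) (hs1 : s.re ≤ 1) (k : ℕ) (a : ℝ) :
    ‖χ.LFunction s‖ ^ k * (q : ℝ) ^ (-(a * (1 - s.re))) ≤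
      (Real.exp (3 / 2) * (1 + Real.log q) ^ (2 - s.re) * ‖s‖) ^ k *
        (q : ℝ) ^ (((k : ℝ) / 2 - a) * (1 - s.re)) := by
  set C : ℝ := (Real.exp (3 / 2) * (1 + Real.log q) ^ (2 - s.re) * ‖s‖)
  have hq0 : (0 : ℝ) < q := by exact_mod_cast (show 0 < q by omega)
  have h1 := norm_LFunction_le_logConst_mul_rpow χ hq hχ hs0 hs1
  -- `k`-th power of the pointwise bound
  have hk : ‖χ.LFunction s‖ ^ k ≤ (C * (q : ℝ) ^ ((1 - s.re) / 2)) ^ k :=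
    pow_le_pow_left₀ (norm_nonneg _) h1 k
  have hexp : (C * (q : ℝ) ^ ((1 - s.re) / 2)) ^ k * (q : ℝ) ^ (-(a * (1 - s.re))) =
      C ^ k * (q : ℝ) ^ (((k : ℝ) / 2 - a) * (1 - s.re)) := by
    rw [mul_pow, ← Real.rpow_natCast ((q : ℝ) ^ ((1 - s.re) / 2)) k, ← Real.rpow_mul hq0.le,
      mul_assoc, ← Real.rpow_add hq0]
    congr 2
    ring
  calc ‖χ.LFunction s‖ ^ k * (q : ℝ) ^ (-(a * (1 - s.re)))
      ≤ (C * (q : ℝ) ^ ((1 - s.re) / 2)) ^ k * (q : ℝ) ^ (-(a * (1 - s.re))) :=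
        mul_le_mul_of_nonneg_right hk (Real.rpow_nonneg hq0.le _)
    _ = C ^ k * (q : ℝ) ^ (((k : ℝ) / 2 - a) * (1 - s.re)) := hexp

/-! ### The four instances that are rows of the cell's constraint system -/

/-- Lemma 3.1 of the source (`ν²`, generating function `ζ²L²φ`, cut `D⁴`; `k = 2`, `a = 4`): on the
shifted line the `L`-part of the integrand times `|D^{4s}|` is `≤ C² q^{−3(1−σ)}` — a power saving
by convexity alone ("standard estimates", as printed; row T-ALT1a, `saves_lemma31_convexity`).
[cite: Zhang2022LandauSiegel, Lemma 3.1] -/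
theorem lemma31_shiftedLine_le (hq : 8 ≤ q) (hχ : χ.IsPrimitive) {s : ℂ}
    (hs0 : 1 / 2 ≤ s.re) (hs1 : s.re ≤ 1) :
    ‖χ.LFunction s‖ ^ 2 * (q : ℝ) ^ (-(4 * (1 - s.re))) ≤
      (Real.exp (3 / 2) * (1 + Real.log q) ^ (2 - s.re) * ‖s‖) ^ 2 *
        (q : ℝ) ^ (-(3 * (1 - s.re))) := by
  have h := pow_norm_LFunction_mul_rpow_le χ hq hχ hs0 hs1 2 4
  have he : (((2 : ℕ) : ℝ) / 2 - 4) * (1 - s.re) = -(3 * (1 - s.re)) := by push_cast; ring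
  rwa [he] at h

/-- The cell's Lemma 3.2♭ = ALT-1 variant A11 (`ν²τ₂`, generating function `ζ⁴L⁴φ♭`, cut `D⁴`;
`k = 4`, `a = 4`): `≤ C⁴ q^{−2(1−σ)}` — a power saving WITHOUT any subconvex input, because the cut
`D⁴` exceeds the square root `D²` of the conductor of `L⁴` (row T-ALT1f,
`saves_lemma32flat_convexity`). Combined with
`Section3SigmaSplitting.sum_sigma_sq_div_le_source_log_pow` this is the analytic half of the
statement that the manuscript's only subconvex input is removable at the printed exponents.
[folklore] -/
theorem lemma32flat_shiftedLine_le (hq : 8 ≤ q) (hχ : χ.IsPrimitive) {s : ℂ}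
    (hs0 : 1 / 2 ≤ s.re) (hs1 : s.re ≤ 1) :
    ‖χ.LFunction s‖ ^ 4 * (q : ℝ) ^ (-(4 * (1 - s.re))) ≤
      (Real.exp (3 / 2) * (1 + Real.log q) ^ (2 - s.re) * ‖s‖) ^ 4 *
        (q : ℝ) ^ (-(2 * (1 - s.re))) := by
  have h := pow_norm_LFunction_mul_rpow_le χ hq hχ hs0 hs1 4 4
  have he : (((4 : ℕ) : ℝ) / 2 - 4) * (1 - s.re) = -(2 * (1 - s.re)) := by push_cast; ring
  rwa [he] at h

/-- The printed Lemma 3.2 (`ν²τ₂²`, generating function `ζ⁸L⁸φ*`, cut `D⁴`; `k = 8`, `a = 4`) at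
Pólya–Vinogradov / convexity strength: the majorant is `≤ C⁸ · q⁰ = C⁸` only — NO decay in `q`,
so "residue + O(D^{−c})" does not follow from the estimates that carry Lemma 3.1 (row T-ALT1c,
`not_saves_lemma32_convexity`); the printed route needs `|L(½+it,χ)| ≪ q^{μ+ε}` with `μ < ¼`
(Burgess `3/16`: [cite: IwaniecKowalski2004, Thm 12.9]; not in the tree). A statement about the
route, not about the lemma. -/
theorem lemma32_shiftedLine_le_polyaVinogradov (hq : 8 ≤ q) (hχ : χ.IsPrimitive) {s : ℂ}
    (hs0 : 1 / 2 ≤ s.re) (hs1 : s.re ≤ 1) :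
    ‖χ.LFunction s‖ ^ 8 * (q : ℝ) ^ (-(4 * (1 - s.re))) ≤
      (Real.exp (3 / 2) * (1 + Real.log q) ^ (2 - s.re) * ‖s‖) ^ 8 := by
  have h := pow_norm_LFunction_mul_rpow_le χ hq hχ hs0 hs1 8 4
  have he : (((8 : ℕ) : ℝ) / 2 - 4) * (1 - s.re) = 0 := by push_cast; ring
  rwa [he, Real.rpow_zero, mul_one] at h

/-- ALT-1 design variant A6 (approximants of length `D⁵`: `k = 8`, `a = 5`): convexity saves again,
`≤ C⁸ q^{−(1−σ)}` (`saves_lemma32_convexity_cut_iff : Saves 8 c_F ¼ ↔ 4 < c_F`). [folklore] -/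
theorem lemma32_cut5_shiftedLine_le (hq : 8 ≤ q) (hχ : χ.IsPrimitive) {s : ℂ}
    (hs0 : 1 / 2 ≤ s.re) (hs1 : s.re ≤ 1) :
    ‖χ.LFunction s‖ ^ 8 * (q : ℝ) ^ (-(5 * (1 - s.re))) ≤
      (Real.exp (3 / 2) * (1 + Real.log q) ^ (2 - s.re) * ‖s‖) ^ 8 *
        (q : ℝ) ^ (-(1 - s.re)) := by
  have h := pow_norm_LFunction_mul_rpow_le χ hq hχ hs0 hs1 8 5
  have he : (((8 : ℕ) : ℝ) / 2 - 5) * (1 - s.re) = -(1 - s.re) := by push_cast; ring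
  rwa [he] at h

/-! ### Link with the saving rule `Saves k a μ := 2kμ < a` at `μ = ¼` -/

/-- For `σ < 1` the `q`-exponent `(k/2 − a)(1−σ)` of the shifted-line majorant is negative — the
majorant decays as a power of `q` — iff `Saves k a ¼` (`2k·¼ < a`). [folklore] -/
theorem exponent_neg_iff_saves (k : ℕ) (a : ℚ) {σ : ℝ} (hσ : σ < 1) :
    ((k : ℝ) / 2 - (a : ℝ)) * (1 - σ) < 0 ↔ Saves k a (1 / 4) := by
  have h1 : (0 : ℝ) < 1 - σ := by linarith
  have hS : Saves k a (1 / 4) ↔ (k : ℝ) / 2 - (a : ℝ) < 0 := by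
    unfold Saves
    rw [← Rat.cast_lt (K := ℝ)]
    push_cast
    constructor <;> intro h <;> linarith
  rw [hS]
  constructor
  · intro h
    by_contra h'
    have : 0 ≤ ((k : ℝ) / 2 - (a : ℝ)) * (1 - σ) := mul_nonneg (not_lt.mp h') h1.le
    linarith
  · intro h
    exact mul_neg_of_neg_of_pos h h1

/-- Summary row: the three cut-`D⁴` instances side by side — Lemma 3.1 and Lemma 3.2♭ decay
(`Saves 2 4 ¼`, `Saves 4 4 ¼`), the printed Lemma 3.2 does not (`¬ Saves 8 4 ¼`) — restated from
`Section3SubconvexInput` so that this file's four instances and the rational rows are visibly the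
same table. [cite: Zhang2022LandauSiegel, §3 Lemmas 3.1–3.2] -/
theorem saves_table :
    Saves 2 4 (1 / 4) ∧ Saves 4 4 (1 / 4) ∧ ¬ Saves 8 4 (1 / 4) ∧ Saves 8 5 (1 / 4) :=
  ⟨Section3SubconvexInput.saves_lemma31_convexity,
   Section3SubconvexInput.saves_lemma32flat_convexity,
   Section3SubconvexInput.not_saves_lemma32_convexity,
   (Section3SubconvexInput.saves_lemma32_convexity_cut_iff 5).2 (by norm_num)⟩

end Literature.NumberTheory.LFunctions.Zhang2022.Section3ShiftedLineMajorant

end
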